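import Summits.BirchSwinnertonDyer.BirchSwinnertonDyer.Theorems.QuadraticBranchSignedControlPlusEtaNonsurjRankLeOneLeaf
import Summits.BirchSwinnertonDyer.BirchSwinnertonDyer.Theorems.QuadraticBranchSignedControlPlusEtaNonsurjCartanRows
import Literature.NumberTheory.SerreUniformity.Statement
import Literature.NumberTheory.EllipticCurves.BSDSelmerPConverseSerreProofs
import HarnessLib

/-!
# Route `QuadraticBranchSignedControl` (rung K8, cell `bsd-potss`), crux stmt-BirchSwinnertonDyer-19606
# `PlusEtaMainConjectureNonsurj`: Part LV — THE LEAF'S NON-ONTO RESIDUAL, PRIME BY PRIME. At every prime `p`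
# for which `X_ns⁺(p)(ℚ)` is CM (`NonsplitCartanPointsAreCM p`: a THEOREM at `p = 13` (BDMTV 2019) and `p = 17`
# (BDMTV 2023); every `p > 37` under Serre's uniformity question) the route leaf `Additive.O5SharpGss` AT `p` needs,
# beyond the binders of `closes` and print, EXACTLY ONE input: class O10 — `BSD_p(W)` on the CM Gss2 pairs of
# analytic rank one. NO η-main-conjecture statement, NO Conjecture (A), NO analytic `μ` enters at such `p`. The
# η-input of the rank-≤1 face (Part LIII) lives on the window `p ∈ {5, 7, 11, 19, 23, 29, 31, 37}` only
# (granted uniformity; unconditionally: at the primes where `X_ns⁺(p)` has a non-CM rational point)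

WHY. Part LIII split the rank-≤1 face of the crux at the leaf into the η-input on NON-CM non-onto rows and O10. A
non-onto good `a_p = 0` row at `p ≥ 5` has mod-`p` image exactly `C_ns⁺(p)` (`not_forall_surj_pow_iff_cartanNormalizer`:
Serre's lifting lemma — a tree THEOREM, `serre_hasSurjectiveModNGaloisRep_pow_holds` — and the exact-image theorem at
a supersingular prime), i.e. is a `ℚ`-point of `X_ns⁺(p)`; so at a prime where those points are all CM there ARE no
non-CM non-onto rows and the η-input is vacuous. k8eta-c2 g17/g18 drew the same picture in NODE currency
(`EtaBDMTVPrimes.…_of_cmInputs_of_eq_13_or_17`, `…NonCMWindow`), where the CM rows still cost (A) + analytic `μ`;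
in LEAF currency (Part LIII) the CM rows cost bsd.S28 (print, `r_an = 0`) and O10 (`r_an = 1`) and nothing else.

* §1 `hasCM_of_row_of_nonsplitCartanPointsAreCM` — at a prime `p ≥ 5` with `NonsplitCartanPointsAreCM p`, every
  non-onto good `a_p = 0` row is CM (general-`p` form of g17's `hasCM_of_row_of_eq_13_or_17`).
* §2 `missingPPartAt_of_closesBinders_of_cmRankOneBSDp_of_nonsplitCartanPointsAreCM` — THE LEAF AT SUCH A PRIME:
  for a Gss2 pair `(W, p)`, `p ≥ 5`, `r_an(W) ≤ 1`, `NonsplitCartanPointsAreCM p`: `MissingPPartAt W p` from `closes`'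
  binders `hKoN h12 hZc hQc hE h₂ h₄ hP hKO`, bsd.S28, and O10 AT `p` (`MissingPPartAt` on the CM pairs `(W′, p)` with
  `r_an(W′) = 1`). Non-CM pairs: every twin is tower-onto (§1), so the FE-free Kato consumer of `closes` gives (C1_η)
  at the twin and Part L §2 the leaf; CM pairs: Part LIII §1 (`r_an = 0`) / O10 (`r_an = 1`).
* §3 `…_thirteen` / `…_seventeen` — `p = 13`, `17` with the BDMTV named facts (`h13`, `h17`); `…_of_serreUniformityBound_of_gt_37`
  — every `p > 37` under `SerreUniformityBound 37`.
* §4 **`o5SharpGss_of_closesBinders_of_cmRankOneBSDp_of_etaNonCM_offCMPrimes`** — the WHOLE leaf from `closes`' binders,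
  bsd.S28, O10, and the η-input demanded ONLY at primes `p` with `¬ NonsplitCartanPointsAreCM p` (fact-free in `p`); and
  **`…_of_etaNonCM_window`** — the same with the η-input demanded only for `5 ≤ p ≤ 37`, `p ∉ {13, 17}`, GRANTED
  `h13 h17` (print) and `SerreUniformityBound 37` (OPEN, hypothesis position).

NUMBERS (cell census, Gss2 pairs `N_W < 5·10⁵`, P-34R): all 30 non-CM non-onto in-table rows sit at `p = 5`
(`X_ns⁺(5)`, `X_ns⁺(7)` have genus 0 and `X_ns⁺(11)(ℚ)` is infinite, so the window primes 5, 7, 11 carry infinitely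
many non-CM rows class-wide; 19–37: none known, finitely many expected); CM rows occur at every inert `p`.

HONEST FRAMING (cell `bsd-potss`, run/shared/lean/pub/bsd-potss/; FULL-BSD rank ≤ 1 programme, HUMAN RULING
D-0036/D-0074): COMPOSITION THEOREMS ONLY — no definition, no new named fact, no `sorry`, axioms standard; CONDITIONAL
on the displayed route binders (items, open or held), the named facts `h13`/`h17` (print, hypothesis position), the
OPEN predicate `SerreUniformityBound 37` where displayed, and O10 (OPEN, not in print). Nothing is closed, filed or
re-typed; `BSD(W, p)` is claimed for no pair. Seat `bsd-potss-k8eta-c2` g35 (prover), `--supports stmt-BirchSwinnertonDyer-19606`.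

References: [BalakrishnanEtAl2019] Cor. 1.3; [BalakrishnanEtAl2023] Thm. 1.2; [SerreKyoto1977] questions 6.5–6.6;
[Serre1972] §1.11 Prop. 12, §2.7 Prop. 17; [SerreAbelianLadic1968] IV §3.4 Lemma 3; [BurungaleFlach2024] Thm 1.1, Cor. 2;
[Kobayashi2003] Thm. 1.2, §4, Thm. 7.4; [KitajimaOtsuki2018] Main Thm. 1.3; [Mazur1978] Cor. 4.1; [Miller2011LMS] Def. 1.1.
-/

set_option autoImplicit false
set_option linter.dupNamespace false

noncomputable section

open scoped Classical MatrixGroups ModularForm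

open CongruenceSubgroup Field WeierstrassCurve
open Literature.NumberTheory.EllipticCurves
open Literature.NumberTheory.EllipticCurves.ModularForms
open Literature.NumberTheory.EllipticCurves.Kobayashi2003
open Literature.NumberTheory.EllipticCurves.Rank1Residual
open Literature.NumberTheory.EllipticCurves.Rank1Residual.Typed
open Literature.NumberTheory.GaloisRepresentations
open Literature.NumberTheory.GaloisCohomology
open Literature.NumberTheory.SerreUniformity
open Summit.BirchSwinnertonDyer.Rank1Residual.Additive
open Summit.BirchSwinnertonDyer.BirchSwinnertonDyer.Theses.QuadraticBranchSignedControl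

namespace Summit.BirchSwinnertonDyer.BirchSwinnertonDyer.Theorems

namespace EtaRankLeOneLeafCMPrimes

/-! ## §1 At a prime where `X_ns⁺(p)(ℚ)` is CM, every non-onto row is CM -/

/-- **Every non-onto good `a_p = 0` row at a prime `p ≥ 5` with `NonsplitCartanPointsAreCM p` is CM**: the row's mod-`p`
image is exactly the normaliser of a non-split Cartan subgroup (`not_forall_surj_pow_iff_cartanNormalizer`: Serre's
lifting lemma — tree theorem — and the exact image at a supersingular prime), and the hypothesis says such curves are
CM. General-`p` form of k8eta-c2 g17's `EtaBDMTVPrimes.hasCM_of_row_of_eq_13_or_17`; the predicate is a THEOREM only at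
`13`, `17` and is a hypothesis here. [cite: SerreKyoto1977, questions 6.5–6.6, pp. 187–188]
[cite: Serre1972, §1.11 Prop. 12, §2.7 Prop. 17] -/
theorem hasCM_of_row_of_nonsplitCartanPointsAreCM {p : ℕ} [Fact p.Prime] (hX : NonsplitCartanPointsAreCM p)
    (V : WeierstrassCurve ℚ) [V.IsElliptic] [V.IsGloballyMinimal] (hp5 : 5 ≤ p)
    (hgood : V.HasGoodReductionAtPrime p) (hap : V.frobeniusTrace p = 0)
    (hns : ¬ ∀ m : ℕ, V.HasSurjectiveModNGaloisRep (p ^ m : ℕ)) : V.HasCM :=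
  hX V ((not_forall_surj_pow_iff_cartanNormalizer V p hp5 hgood hap).mp hns).hasNonsplitCartanModPImage

/-- **… so at such a prime every twin of a NON-CM partner is tower-onto.** [cite: SerreKyoto1977, questions 6.5–6.6] -/
theorem forall_surj_pow_twin_of_not_hasCM_of_nonsplitCartanPointsAreCM {p : ℕ} [Fact p.Prime]
    (hX : NonsplitCartanPointsAreCM p) (W : WeierstrassCurve ℚ) [W.IsElliptic] (hCM : ¬ W.HasCM) (hp5 : 5 ≤ p)
    (V : WeierstrassCurve ℚ) [V.IsElliptic] [V.IsGloballyMinimal] (C : VariableChange ℚ)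
    (hCV : C • W.quadraticTwist ((-1 : ℚ) ^ (p / 2) * p) = V)
    (hgood : V.HasGoodReductionAtPrime p) (hap : V.frobeniusTrace p = 0) :
    ∀ m : ℕ, V.HasSurjectiveModNGaloisRep (p ^ m : ℕ) := by
  by_contra hns
  exact EtaRankLeOneLeaf.not_hasCM_twin_of_not_hasCM W p V C hCV hCM
    (hasCM_of_row_of_nonsplitCartanPointsAreCM hX V hp5 hgood hap hns)

/-! ## §2 The leaf at such a prime: `closes`' binders, bsd.S28 and O10 at `p` — nothing else -/

/-- **THE LEAF AT A PRIME WHERE `X_ns⁺(p)(ℚ)` IS CM.** For a Gss2 pair `(W, p)` (`Addv W p ∧ SubGss W p`), `p ≥ 5`,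
`r_an(W) ≤ 1`, with `NonsplitCartanPointsAreCM p`: `ord_p #Ш(W) = ord_p #Ш_an(W)` from the binders of `closes`
(`hKoN h12 hZc hQc hE h₂ h₄ hP hKO`, verbatim), bsd.S28 (`hS28`, print) and **O10 at `p`** (`hO10p`: `MissingPPartAt` on
the CM Gss2 pairs `(W′, p)` with `r_an(W′) = 1`). No η-main-conjecture statement, no (A), no analytic `μ`: a non-CM
pair has only tower-onto twins (§1), served by the FE-free Kato consumer of `closes` and Part L §2; a CM pair is bsd.S28
(`r_an = 0`, Part LIII §1) or O10 (`r_an = 1`). CONDITIONAL on the displayed binders and the OPEN input O10; nothing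
booked; no pair's `BSD(W, p)` is claimed. [cite: SerreKyoto1977, questions 6.5–6.6] [cite: BurungaleFlach2024, Thm 1.1 and Cor. 2]
[cite: Kobayashi2003, Thm. 1.2 (p. 2), §4 (p. 8), Thm. 7.4 (p. 13)] [cite: KitajimaOtsuki2018, Main Thm. 1.3]
[cite: Mazur1978, Cor. 4.1] [cite: Miller2011LMS, §1 and Def. 1.1] -/
theorem missingPPartAt_of_closesBinders_of_cmRankOneBSDp_of_nonsplitCartanPointsAreCM
    (hKoN : PlusKatoDivisibilityBranchOntoIotaOfNamedInputs) (h12 : PublishedInputKobThm12OntoIota)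
    (hZc : PublishedInputKobZetaEtaContraOnto) (hQc : PublishedInputKatoThm134ContraOnto) (hE : PlusLowerInclusionSurjBranch)
    (hS28 : bsdTriple_of_hasCM_of_L_one_ne_zero)
    (h₂ : EtaTransportSigned) (h₄ : PAdicGrossZagierBranch) (hP : PublishedInputsGss2) (hKO : PublishedInputKO13)
    (W : WeierstrassCurve ℚ) [W.IsElliptic] [W.IsGloballyMinimal] (p : ℕ) [hp : Fact p.Prime]
    (hX : NonsplitCartanPointsAreCM p)
    (hO10p : ∀ (W' : WeierstrassCurve ℚ) [W'.IsElliptic] [W'.IsGloballyMinimal],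
      W'.HasCM → W'.analyticRank = 1 → Addv W' p → SubGss W' p → MissingPPartAt W' p)
    (hp5 : 5 ≤ p) (hr : W.analyticRank ≤ 1) (hadd : Addv W p) (hGss : SubGss W p) :
    MissingPPartAt W p := by
  -- (R2±) from Kitajima–Otsuki 2018 Main Thm. 1.3 — as in `closes`
  have h₃a : NoFiniteSubmodulePlus := fun W _ _ p _ hp5 =>
    SignedTwist.evenBranchPlusNoFiniteSubmoduleAt_of_kitajimaOtsuki13PlusEta W p
      fun K₀ _ _ _ _ ηq hηK V _ _ hp2 hgood hap κ γ hκ hγ hγK D hfin htor M hM =>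
        hKO p K₀ ηq hηK V hp2 hgood hap κ γ hκ hγ hγK 1
          { X := D.X
            addCommGroup := D.addCommGroup
            module := D.module
            conj_mem := D.conj_mem
            toDual := D.toDual
            bijective := D.bijective
            toDual_T_smul := D.toDual_T_smul
            toDual_C_smul := D.toDual_C_smul }
          hfin htor M hM
  have h₃b : NoFiniteSubmoduleMinus := fun W _ _ p _ hp5 =>
    SignedTwist.oddBranchStrictMinusNoFiniteSubmoduleAt_of_kitajimaOtsuki13MinusEta W p
      fun K₀ _ _ _ _ ηq hηK V _ _ hp2 hgood hap κ γ hκ hγ hγK D hfin htor M hM =>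
        hKO p K₀ ηq hηK V hp2 hgood hap κ γ hκ hγ hγK (-1)
          { X := D.X
            addCommGroup := D.addCommGroup
            module := D.module
            conj_mem := D.conj_mem
            toDual := D.toDual
            bijective := D.bijective
            toDual_T_smul := D.toDual_T_smul
            toDual_C_smul := D.toDual_C_smul }
          hfin htor M hM
  have h₃ : NoFiniteSubmoduleSigned := fun W _ _ p _ hp => ⟨h₃a W p hp, h₃b W p hp⟩
  obtain ⟨hGZK, hmod, hnf, hGZ, hPT, hM⟩ := hP
  by_cases hCM : W.HasCM
  · -- CM pairs: bsd.S28 at the leaf (analytic rank 0) / O10 at `p` (analytic rank 1)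
    rcases Nat.le_one_iff_eq_zero_or_eq_one.mp hr with h0 | h1
    · exact EtaRankLeOneLeaf.missingPPartAt_of_hasCM_of_analyticRank_eq_zero hmod hS28 W p hCM h0
    · exact hO10p W hCM h1 hadd hGss
  · -- non-CM pairs: every twin is tower-onto (§1), so the FE-free Kato consumer of `closes` gives (C1_η) at it
    refine EtaRankLeOneFace.missingPPartAt_of_plusMCAtTwin_of_mazur hGZK hmod hnf hGZ hPT hM h₂ h₃ h₄ W p ?_ hr hp5
      hadd hGss
    intro V _ _ C hCV hgood hap
    have hs := forall_surj_pow_twin_of_not_hasCM_of_nonsplitCartanPointsAreCM hX W hCM hp5 V C hCV hgood hap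
    exact quadraticBranchPlusMainConjectureAt_of_katoDivisibilityIota_of_lowerInclusion
      (hKoN h12 hZc hQc V p hp5 hgood hap hs) hs (hE V p hp5 hgood hap hs)

/-! ## §3 `p = 13`, `p = 17` (BDMTV); every `p > 37` under Serre's uniformity question -/

/-- **THE LEAF AT `p = 13`**: for every Gss2 pair `(W, 13)` of analytic rank `≤ 1`, `ord₁₃ #Ш(W) = ord₁₃ #Ш_an(W)` from the
binders of `closes`, bsd.S28, the PUBLISHED theorem «`X_ns⁺(13)(ℚ)` is CM» (Balakrishnan–Dogra–Müller–Tuitman–Vonk 2019,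
Cor. 1.3; named fact `BDMTV2019_nonsplitCartan_level13`, hypothesis position) and O10 AT 13 ONLY. The rung's non-onto
residual at `13` is O10 verbatim. CONDITIONAL; nothing booked. [cite: BalakrishnanEtAl2019, Cor. 1.3]
[cite: BurungaleFlach2024, Thm 1.1 and Cor. 2] [cite: Kobayashi2003, §4 (p. 8), Thm. 7.4 (p. 13)] [cite: Miller2011LMS, Def. 1.1] -/
theorem missingPPartAt_thirteen_of_closesBinders_of_cmRankOneBSDp [Fact (Nat.Prime 13)]
    (hKoN : PlusKatoDivisibilityBranchOntoIotaOfNamedInputs) (h12 : PublishedInputKobThm12OntoIota)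
    (hZc : PublishedInputKobZetaEtaContraOnto) (hQc : PublishedInputKatoThm134ContraOnto) (hE : PlusLowerInclusionSurjBranch)
    (hS28 : bsdTriple_of_hasCM_of_L_one_ne_zero)
    (h₂ : EtaTransportSigned) (h₄ : PAdicGrossZagierBranch) (hP : PublishedInputsGss2) (hKO : PublishedInputKO13)
    (h13 : BDMTV2019_nonsplitCartan_level13)
    (hO10p : ∀ (W' : WeierstrassCurve ℚ) [W'.IsElliptic] [W'.IsGloballyMinimal],
      W'.HasCM → W'.analyticRank = 1 → Addv W' 13 → SubGss W' 13 → MissingPPartAt W' 13)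
    (W : WeierstrassCurve ℚ) [W.IsElliptic] [W.IsGloballyMinimal]
    (hr : W.analyticRank ≤ 1) (hadd : Addv W 13) (hGss : SubGss W 13) : MissingPPartAt W 13 :=
  missingPPartAt_of_closesBinders_of_cmRankOneBSDp_of_nonsplitCartanPointsAreCM hKoN h12 hZc hQc hE hS28 h₂ h₄ hP hKO
    W 13 h13 hO10p (by norm_num) hr hadd hGss

/-- **THE LEAF AT `p = 17`**: as at `13`, with «`X_ns⁺(17)(ℚ)` is CM» (BDMTV 2023, Thm. 1.2; named fact
`BDMTV2023_nonsplitCartan_level17`) and O10 at 17 only. CONDITIONAL; nothing booked. [cite: BalakrishnanEtAl2023, Thm. 1.2]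
[cite: BurungaleFlach2024, Thm 1.1 and Cor. 2] [cite: Kobayashi2003, §4 (p. 8), Thm. 7.4 (p. 13)] [cite: Miller2011LMS, Def. 1.1] -/
theorem missingPPartAt_seventeen_of_closesBinders_of_cmRankOneBSDp [Fact (Nat.Prime 17)]
    (hKoN : PlusKatoDivisibilityBranchOntoIotaOfNamedInputs) (h12 : PublishedInputKobThm12OntoIota)
    (hZc : PublishedInputKobZetaEtaContraOnto) (hQc : PublishedInputKatoThm134ContraOnto) (hE : PlusLowerInclusionSurjBranch)
    (hS28 : bsdTriple_of_hasCM_of_L_one_ne_zero)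
    (h₂ : EtaTransportSigned) (h₄ : PAdicGrossZagierBranch) (hP : PublishedInputsGss2) (hKO : PublishedInputKO13)
    (h17 : BDMTV2023_nonsplitCartan_level17)
    (hO10p : ∀ (W' : WeierstrassCurve ℚ) [W'.IsElliptic] [W'.IsGloballyMinimal],
      W'.HasCM → W'.analyticRank = 1 → Addv W' 17 → SubGss W' 17 → MissingPPartAt W' 17)
    (W : WeierstrassCurve ℚ) [W.IsElliptic] [W.IsGloballyMinimal]
    (hr : W.analyticRank ≤ 1) (hadd : Addv W 17) (hGss : SubGss W 17) : MissingPPartAt W 17 :=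
  missingPPartAt_of_closesBinders_of_cmRankOneBSDp_of_nonsplitCartanPointsAreCM hKoN h12 hZc hQc hE hS28 h₂ h₄ hP hKO
    W 17 h17 hO10p (by norm_num) hr hadd hGss

/-- **Under `SerreUniformityBound 37` every prime `p > 37` has `NonsplitCartanPointsAreCM p`** (a non-CM curve with mod-`p`
image in a non-split Cartan normaliser would have onto `ρ̄_{E,p}`, but `C_ns⁺(p) ≠ GL₂(𝔽_p)`: the tree's
`not_surj_of_hasNonsplitCartanModPImage`-type exclusion is packaged in `not_forall_surj_pow_iff_cartanNormalizer`; here we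
argue through the row). Bookkeeping for §3′. [cite: SerreKyoto1977, question 6.5, p. 187] -/
theorem hasCM_of_row_of_serreUniformityBound {p : ℕ} [Fact p.Prime] (hS : SerreUniformityBound 37) (hp37 : 37 < p)
    (V : WeierstrassCurve ℚ) [V.IsElliptic] (hns : ¬ ∀ m : ℕ, V.HasSurjectiveModNGaloisRep (p ^ m : ℕ)) :
    V.HasCM := by
  by_contra hCM
  exact hns (serre_hasSurjectiveModNGaloisRep_pow_holds V p (by omega) (hS V hCM p Fact.out hp37))

/-- **THE LEAF AT EVERY `p > 37` UNDER SERRE'S UNIFORMITY QUESTION** (`SerreUniformityBound 37`, OPEN, hypothesis position):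
for every Gss2 pair `(W, p)`, `p > 37`, `r_an(W) ≤ 1`: `MissingPPartAt W p` from `closes`' binders, bsd.S28 and O10 at `p`
only. CONDITIONAL (uniformity + O10 both open); nothing booked. [cite: SerreKyoto1977, question 6.5, p. 187]
[cite: BurungaleFlach2024, Thm 1.1 and Cor. 2] [cite: Kobayashi2003, §4 (p. 8), Thm. 7.4 (p. 13)] [cite: Miller2011LMS, Def. 1.1] -/
theorem missingPPartAt_of_closesBinders_of_cmRankOneBSDp_of_serreUniformityBound_of_gt_37
    (hKoN : PlusKatoDivisibilityBranchOntoIotaOfNamedInputs) (h12 : PublishedInputKobThm12OntoIota)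
    (hZc : PublishedInputKobZetaEtaContraOnto) (hQc : PublishedInputKatoThm134ContraOnto) (hE : PlusLowerInclusionSurjBranch)
    (hS28 : bsdTriple_of_hasCM_of_L_one_ne_zero)
    (h₂ : EtaTransportSigned) (h₄ : PAdicGrossZagierBranch) (hP : PublishedInputsGss2) (hKO : PublishedInputKO13)
    (hS : SerreUniformityBound 37)
    (W : WeierstrassCurve ℚ) [W.IsElliptic] [W.IsGloballyMinimal] (p : ℕ) [hp : Fact p.Prime] (hp37 : 37 < p)
    (hO10p : ∀ (W' : WeierstrassCurve ℚ) [W'.IsElliptic] [W'.IsGloballyMinimal],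
      W'.HasCM → W'.analyticRank = 1 → Addv W' p → SubGss W' p → MissingPPartAt W' p)
    (hr : W.analyticRank ≤ 1) (hadd : Addv W p) (hGss : SubGss W p) : MissingPPartAt W p := by
  -- (R2±) as in `closes`
  have h₃a : NoFiniteSubmodulePlus := fun W _ _ p _ hp5 =>
    SignedTwist.evenBranchPlusNoFiniteSubmoduleAt_of_kitajimaOtsuki13PlusEta W p
      fun K₀ _ _ _ _ ηq hηK V _ _ hp2 hgood hap κ γ hκ hγ hγK D hfin htor M hM =>
        hKO p K₀ ηq hηK V hp2 hgood hap κ γ hκ hγ hγK 1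
          { X := D.X
            addCommGroup := D.addCommGroup
            module := D.module
            conj_mem := D.conj_mem
            toDual := D.toDual
            bijective := D.bijective
            toDual_T_smul := D.toDual_T_smul
            toDual_C_smul := D.toDual_C_smul }
          hfin htor M hM
  have h₃b : NoFiniteSubmoduleMinus := fun W _ _ p _ hp5 =>
    SignedTwist.oddBranchStrictMinusNoFiniteSubmoduleAt_of_kitajimaOtsuki13MinusEta W p
      fun K₀ _ _ _ _ ηq hηK V _ _ hp2 hgood hap κ γ hκ hγ hγK D hfin htor M hM =>
        hKO p K₀ ηq hηK V hp2 hgood hap κ γ hκ hγ hγK (-1)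
          { X := D.X
            addCommGroup := D.addCommGroup
            module := D.module
            conj_mem := D.conj_mem
            toDual := D.toDual
            bijective := D.bijective
            toDual_T_smul := D.toDual_T_smul
            toDual_C_smul := D.toDual_C_smul }
          hfin htor M hM
  have h₃ : NoFiniteSubmoduleSigned := fun W _ _ p _ hp => ⟨h₃a W p hp, h₃b W p hp⟩
  have hp5 : 5 ≤ p := by omega
  obtain ⟨hGZK, hmod, hnf, hGZ, hPT, hM⟩ := hP
  by_cases hCM : W.HasCM
  · rcases Nat.le_one_iff_eq_zero_or_eq_one.mp hr with h0 | h1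
    · exact EtaRankLeOneLeaf.missingPPartAt_of_hasCM_of_analyticRank_eq_zero hmod hS28 W p hCM h0
    · exact hO10p W hCM h1 hadd hGss
  · refine EtaRankLeOneFace.missingPPartAt_of_plusMCAtTwin_of_mazur hGZK hmod hnf hGZ hPT hM h₂ h₃ h₄ W p ?_ hr hp5
      hadd hGss
    intro V _ _ C hCV hgood hap
    have hs : ∀ m : ℕ, V.HasSurjectiveModNGaloisRep (p ^ m : ℕ) := by
      by_contra hns
      exact EtaRankLeOneLeaf.not_hasCM_twin_of_not_hasCM W p V C hCV hCM
        (hasCM_of_row_of_serreUniformityBound hS hp37 V hns)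
    exact quadraticBranchPlusMainConjectureAt_of_katoDivisibilityIota_of_lowerInclusion
      (hKoN h12 hZc hQc V p hp5 hgood hap hs) hs (hE V p hp5 hgood hap hs)

/-! ## §4 The whole leaf: the η-input only off the CM primes / only on the window -/

/-- **THE LEAF WITH THE η-INPUT DEMANDED ONLY AT THE PRIMES WHERE `X_ns⁺(p)` HAS A NON-CM RATIONAL POINT** (fact-free in
`p`): `Additive.O5SharpGss` from the binders of `closes` (`hKoN h12 hZc hQc hE h₂ h₄ hP hKO hR`), bsd.S28, O10 (`hO10`), and
Kobayashi's even η-main conjecture on the NON-CM non-onto rows with a rank-≤1 partner demanded ONLY at primes `p` with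
`¬ NonsplitCartanPointsAreCM p` (`hNncX`). Part LIII §3 with §2 at the CM primes. CONDITIONAL; nothing booked.
[cite: SerreKyoto1977, questions 6.5–6.6] [cite: Kobayashi2003, §4 (p. 8), Thm. 7.4 (p. 13)]
[cite: BurungaleFlach2024, Thm 1.1 and Cor. 2] [cite: KitajimaOtsuki2018, Main Thm. 1.3] [cite: Mazur1978, Cor. 4.1]
[cite: Miller2011LMS, §1 and Def. 1.1] -/
theorem o5SharpGss_of_closesBinders_of_cmRankOneBSDp_of_etaNonCM_offCMPrimes
    (hKoN : PlusKatoDivisibilityBranchOntoIotaOfNamedInputs) (h12 : PublishedInputKobThm12OntoIota)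
    (hZc : PublishedInputKobZetaEtaContraOnto) (hQc : PublishedInputKatoThm134ContraOnto) (hE : PlusLowerInclusionSurjBranch)
    (hNncX : ∀ (V : WeierstrassCurve ℚ) [V.IsElliptic] [V.IsGloballyMinimal] (p : ℕ) [Fact p.Prime],
      5 ≤ p → ¬ NonsplitCartanPointsAreCM p → V.HasGoodReductionAtPrime p → V.frobeniusTrace p = 0 →
      ¬ (∀ m : ℕ, V.HasSurjectiveModNGaloisRep (p ^ m : ℕ)) → ¬ V.HasCM →
      (∃ (W : WeierstrassCurve ℚ) (_ : W.IsElliptic) (_ : W.IsGloballyMinimal) (C : VariableChange ℚ),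
          C • W.quadraticTwist ((-1 : ℚ) ^ (p / 2) * p) = V ∧ W.analyticRank ≤ 1) →
      QuadraticBranchPlusEtaMainConjectureAt V p)
    (hO10 : ∀ (W : WeierstrassCurve ℚ) [W.IsElliptic] [W.IsGloballyMinimal] (p : ℕ) [Fact p.Prime],
      W.HasCM → W.analyticRank = 1 → 5 ≤ p → Addv W p → SubGss W p → MissingPPartAt W p)
    (hS28 : bsdTriple_of_hasCM_of_L_one_ne_zero)
    (h₂ : EtaTransportSigned) (h₄ : PAdicGrossZagierBranch)
    (hP : PublishedInputsGss2) (hKO : PublishedInputKO13) (hR : Gss2AtThree) :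
    Summit.BirchSwinnertonDyer.Rank1Residual.Additive.O5SharpGss := by
  refine EtaRankLeOneLeaf.o5SharpGss_of_closesBinders_of_etaNonCMRankLeOne_of_cmRankOneBSDp hKoN h12 hZc hQc hE ?_
    hO10 hS28 h₂ h₄ hP hKO hR
  intro V _ _ p _ hp5 hgood hap hns hCM hW
  by_cases hX : NonsplitCartanPointsAreCM p
  · exact absurd (hasCM_of_row_of_nonsplitCartanPointsAreCM hX V hp5 hgood hap hns) hCM
  · exact hNncX V p hp5 hX hgood hap hns hCM hW

/-- **THE LEAF WITH THE η-INPUT ON THE WINDOW `{5, 7, 11, 19, 23, 29, 31, 37}` ONLY**, GRANTED the published theorems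
«`X_ns⁺(13)(ℚ)`, `X_ns⁺(17)(ℚ)` are CM» (`h13`, `h17`) and Serre's uniformity question with bound 37 (`hS`, OPEN, hypothesis
position): `Additive.O5SharpGss` from `closes`' binders, bsd.S28, O10 and the η-input on non-CM non-onto rank-≤1 rows demanded
only for `5 ≤ p ≤ 37`, `p ≠ 13`, `p ≠ 17` (`hNncW`). CONDITIONAL; nothing booked. [cite: BalakrishnanEtAl2019, Cor. 1.3]
[cite: BalakrishnanEtAl2023, Thm. 1.2] [cite: SerreKyoto1977, question 6.5, p. 187] [cite: Kobayashi2003, §4 (p. 8), Thm. 7.4 (p. 13)]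
[cite: BurungaleFlach2024, Thm 1.1 and Cor. 2] [cite: Miller2011LMS, §1 and Def. 1.1] -/
theorem o5SharpGss_of_closesBinders_of_cmRankOneBSDp_of_etaNonCM_window
    (hKoN : PlusKatoDivisibilityBranchOntoIotaOfNamedInputs) (h12 : PublishedInputKobThm12OntoIota)
    (hZc : PublishedInputKobZetaEtaContraOnto) (hQc : PublishedInputKatoThm134ContraOnto) (hE : PlusLowerInclusionSurjBranch)
    (h13 : BDMTV2019_nonsplitCartan_level13) (h17 : BDMTV2023_nonsplitCartan_level17) (hS : SerreUniformityBound 37)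
    (hNncW : ∀ (V : WeierstrassCurve ℚ) [V.IsElliptic] [V.IsGloballyMinimal] (p : ℕ) [Fact p.Prime],
      5 ≤ p → p ≤ 37 → p ≠ 13 → p ≠ 17 → V.HasGoodReductionAtPrime p → V.frobeniusTrace p = 0 →
      ¬ (∀ m : ℕ, V.HasSurjectiveModNGaloisRep (p ^ m : ℕ)) → ¬ V.HasCM →
      (∃ (W : WeierstrassCurve ℚ) (_ : W.IsElliptic) (_ : W.IsGloballyMinimal) (C : VariableChange ℚ),
          C • W.quadraticTwist ((-1 : ℚ) ^ (p / 2) * p) = V ∧ W.analyticRank ≤ 1) →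
      QuadraticBranchPlusEtaMainConjectureAt V p)
    (hO10 : ∀ (W : WeierstrassCurve ℚ) [W.IsElliptic] [W.IsGloballyMinimal] (p : ℕ) [Fact p.Prime],
      W.HasCM → W.analyticRank = 1 → 5 ≤ p → Addv W p → SubGss W p → MissingPPartAt W p)
    (hS28 : bsdTriple_of_hasCM_of_L_one_ne_zero)
    (h₂ : EtaTransportSigned) (h₄ : PAdicGrossZagierBranch)
    (hP : PublishedInputsGss2) (hKO : PublishedInputKO13) (hR : Gss2AtThree) :
    Summit.BirchSwinnertonDyer.Rank1Residual.Additive.O5SharpGss := by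
  refine EtaRankLeOneLeaf.o5SharpGss_of_closesBinders_of_etaNonCMRankLeOne_of_cmRankOneBSDp hKoN h12 hZc hQc hE ?_
    hO10 hS28 h₂ h₄ hP hKO hR
  intro V _ _ p _ hp5 hgood hap hns hCM hW
  by_cases h37 : 37 < p
  · exact absurd (hasCM_of_row_of_serreUniformityBound hS h37 V hns) hCM
  by_cases hp13 : p = 13
  · subst hp13
    exact absurd (hasCM_of_row_of_nonsplitCartanPointsAreCM h13 V hp5 hgood hap hns) hCM
  by_cases hp17 : p = 17
  · subst hp17
    exact absurd (hasCM_of_row_of_nonsplitCartanPointsAreCM h17 V hp5 hgood hap hns) hCM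
  exact hNncW V p hp5 (not_lt.mp h37) hp13 hp17 hgood hap hns hCM hW

/-- A prime `p` with `5 ≤ p < 13` is `5`, `7` or `11`. [folklore] -/
theorem prime_eq_five_or_seven_or_eleven {p : ℕ} (hp : p.Prime) (h5 : 5 ≤ p) (h13 : ¬ 13 ≤ p) :
    p = 5 ∨ p = 7 ∨ p = 11 := by
  interval_cases p
  · exact Or.inl rfl
  · exact absurd hp (by norm_num)
  · exact Or.inr (Or.inl rfl)
  · exact absurd hp (by norm_num)
  · exact absurd hp (by norm_num)
  · exact absurd hp (by norm_num)
  · exact Or.inr (Or.inr rfl)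
  · exact absurd hp (by norm_num)

/-- **THE LEAF WITH THE η-INPUT AT `p ∈ {5, 7, 11}` ONLY, GRANTED the determination of `X_ns⁺(p)(ℚ)` for every prime
`p ≥ 13`** — a THEOREM at `13`, `17` (BDMTV; `h13`, `h17` are implied by `hX13` and not repeated) and the EXPECTED answer
(CM points only) at every `p ≥ 19` (Balakrishnan, ICM 2026, Problem 6.1; OPEN — `hX13 : ∀ p ≥ 13, NonsplitCartanPointsAreCM p`
in hypothesis position, no uniformity statement needed): `Additive.O5SharpGss` from `closes`' binders, bsd.S28, O10 and the
η-input on non-CM non-onto rank-≤1 rows at `p = 5, 7, 11` (`hNnc5711`) — the three primes where `X_ns⁺(p)(ℚ)` is infinite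
(genus `0`, `0`, and the rank-one elliptic curve `X_ns⁺(11)`), hence where non-CM rows provably exist in infinite families.
CONDITIONAL; nothing booked. [cite: BalakrishnanEtAl2019, Cor. 1.3] [cite: BalakrishnanEtAl2023, Thm. 1.2]
[cite: SerreKyoto1977, questions 6.5–6.6] [cite: Kobayashi2003, §4 (p. 8), Thm. 7.4 (p. 13)] [cite: BurungaleFlach2024, Thm 1.1 and Cor. 2]
[cite: Miller2011LMS, §1 and Def. 1.1] -/
theorem o5SharpGss_of_closesBinders_of_cmRankOneBSDp_of_etaNonCM_five_seven_eleven
    (hKoN : PlusKatoDivisibilityBranchOntoIotaOfNamedInputs) (h12 : PublishedInputKobThm12OntoIota)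
    (hZc : PublishedInputKobZetaEtaContraOnto) (hQc : PublishedInputKatoThm134ContraOnto) (hE : PlusLowerInclusionSurjBranch)
    (hX13 : ∀ p : ℕ, p.Prime → 13 ≤ p → NonsplitCartanPointsAreCM p)
    (hNnc5711 : ∀ (V : WeierstrassCurve ℚ) [V.IsElliptic] [V.IsGloballyMinimal] (p : ℕ) [Fact p.Prime],
      (p = 5 ∨ p = 7 ∨ p = 11) → V.HasGoodReductionAtPrime p → V.frobeniusTrace p = 0 →
      ¬ (∀ m : ℕ, V.HasSurjectiveModNGaloisRep (p ^ m : ℕ)) → ¬ V.HasCM →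
      (∃ (W : WeierstrassCurve ℚ) (_ : W.IsElliptic) (_ : W.IsGloballyMinimal) (C : VariableChange ℚ),
          C • W.quadraticTwist ((-1 : ℚ) ^ (p / 2) * p) = V ∧ W.analyticRank ≤ 1) →
      QuadraticBranchPlusEtaMainConjectureAt V p)
    (hO10 : ∀ (W : WeierstrassCurve ℚ) [W.IsElliptic] [W.IsGloballyMinimal] (p : ℕ) [Fact p.Prime],
      W.HasCM → W.analyticRank = 1 → 5 ≤ p → Addv W p → SubGss W p → MissingPPartAt W p)
    (hS28 : bsdTriple_of_hasCM_of_L_one_ne_zero)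
    (h₂ : EtaTransportSigned) (h₄ : PAdicGrossZagierBranch)
    (hP : PublishedInputsGss2) (hKO : PublishedInputKO13) (hR : Gss2AtThree) :
    Summit.BirchSwinnertonDyer.Rank1Residual.Additive.O5SharpGss := by
  refine EtaRankLeOneLeaf.o5SharpGss_of_closesBinders_of_etaNonCMRankLeOne_of_cmRankOneBSDp hKoN h12 hZc hQc hE ?_
    hO10 hS28 h₂ h₄ hP hKO hR
  intro V _ _ p hp hp5 hgood hap hns hCM hW
  by_cases h13 : 13 ≤ p
  · exact absurd (hasCM_of_row_of_nonsplitCartanPointsAreCM (hX13 p hp.out h13) V hp5 hgood hap hns) hCM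
  · exact hNnc5711 V p (prime_eq_five_or_seven_or_eleven hp.out hp5 h13) hgood hap hns hCM hW

end EtaRankLeOneLeafCMPrimes

end Summit.BirchSwinnertonDyer.BirchSwinnertonDyer.Theorems

end
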